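import Summits.PneNP.PneNP.Theses.DirichletPigeons

/-!
# Birth skeleton (BC3) for the split piece `MinkowskiToDirichlet` (C3, stmt-PneNP-10862) — line `hecke-normal-form`

Crux (piece 2 of the split of `GsaPriceOfDimension`, route PneNP/DirichletPigeons; an EXISTING crux):
`MinkowskiToDirichlet : ∃ c > 0, ∀ δ > 0, dirichletInExpTime δ → minkowskiInExpTime (c·δ)` — a
fine-grained, dimension-linear reduction MINKOWSKI_∞ ≤ DIRICHLET (the converse of BJPPR's
DIRICHLET ≤ MINKOWSKI [BanEtAl2019]).

LINE `hecke-normal-form`: factor the reduction through two NORMAL FORMS of MINKOWSKI_∞, typed over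
the DIRICHLET instance type `(Σ d, ℤ^d) × ℕ × ℕ` and its bit code `encD`:

* HECKE FORM — the Construction-A / Hecke lattices `Λ(a, D, s) ⊂ ℤ^{d+1}` generated by the rows
  `(s, a₁, …, a_d)` and `D·eᵢ` (`i = 1..d`), `det = s·D^d`, `n = d+1`; instance `K = (⟨d,a⟩, D, s)`,
  promise `1 ≤ D, 1 ≤ s`; a MINKOWSKI_∞ solution is `z = (q, p₁..p_d) ≠ 0` with
  `|s q|^{d+1} ≤ s D^d` and `|q aᵢ + D pᵢ|^{d+1} ≤ s D^d` (these are the duals of the Goldstein–Mayer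
  lattices `{y : y₀ + a·y ≡ 0 mod D}` of the route's dictionary);
* POWER FORM — the Hecke instances with `D = s·Q^{d+1}`: instance `P = (⟨d,a⟩, s, Q)`, promise
  `1 ≤ s, 1 ≤ Q`, same solution predicate with `D := s·Q^{d+1}`.

Stubs (registered):
* `stub_heckeOfMinkowski` (A1, structural normal form; Paz–Schnorr cyclic approximation, HNF, the
  integrality slack `⌊det^{1/n}⌋`): MINKOWSKI_∞ ≤ Hecke-form MINKOWSKI_∞, exponent-linear.  HARDEST.
* `stub_heckeOfPower` (A2, arithmetic rounding of the modulus to the power form `D = s·Q^{d+1}` —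
  the step where "the exact box is the whole difficulty"; may need dimension padding): Hecke form ≤
  power form, exponent-linear.
* `stub_powerOfDirichlet` (B, PROVABLE NOW up to TM plumbing): power form ≤ DIRICHLET with `c = 1`:
  on `P = (⟨d,a⟩, s, Q)` call DIRICHLET`(a, b := s·Q^{d+1}, Q)`; its answer `1 ≤ q ≤ Q^d`,
  `|q aᵢ/b − pᵢ| < 1/Q` (`pᵢ = round(q aᵢ/b)`) gives `z = (q, −p)`: `|s q|^{d+1} ≤ (s Q^d)^{d+1} = s b^d`
  and `|q aᵢ − b pᵢ|^{d+1} < (b/Q)^{d+1} = (s Q^d)^{d+1} = s b^d` — Dirichlet's box IS Minkowski's cube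
  for these lattices.
* `MinkowskiToDirichlet_of : A1 → A2 → B → MinkowskiToDirichlet` (constants multiply).

The crux is the ROUTE DECL `Summit.PneNP.PneNP.Theses.DirichletPigeons.MinkowskiToDirichlet`, imported.
-/

set_option linter.dupNamespace false

namespace Summit.PneNP.PneNP.Cruxes.GsaPriceOfDimension.HeckeNormalForm

open scoped Classical
open Summit.PneNP.PneNP.Theses.DirichletPigeons (MinkowskiToDirichlet)
open Literature.Computability.Complexity

/-! ### Named forms of the route's inline vocabulary (definitionally the `let` bodies) -/

def dn : ℚ → ℚ := fun x => |x - ((round x : ℤ) : ℚ)|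
def ivec : Computability.Encoding (Σ n : ℕ, Fin n → ℤ) Bool := Computability.Encoding.sigmaBool fun n => Literature.Computability.Complexity.encodingFinVec Literature.Computability.Complexity.encodingIntBool n
/-- Bit code of DIRICHLET-type instances `(⟨d, a⟩, b, Q)` — reused for the Hecke and power forms. -/
def encD : ((Σ d : ℕ, Fin d → ℤ) × ℕ × ℕ) → List Bool := (ivec.pairBool (Computability.encodingNatBool.pairBool Computability.encodingNatBool)).encode
def solD : ((Σ d : ℕ, Fin d → ℤ) × ℕ × ℕ) → ℕ → Prop := fun J q => 1 ≤ q ∧ q ≤ J.2.2 ^ J.1.1 ∧ ∀ i : Fin J.1.1, dn ((q : ℚ) * J.1.2 i / J.2.1) < 1 / (J.2.2 : ℚ)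
def expPoly : ℝ → (ℕ → ℕ → ℕ) → Prop := fun δ T => ∃ c : ℕ, ∀ n L : ℕ, (T n L : ℝ) ≤ c * (2 : ℝ) ^ (δ * n) * ((L : ℝ) + 1) ^ c
def dirichletInExpTime : ℝ → Prop := fun δ => ∃ f : ((Σ d : ℕ, Fin d → ℤ) × ℕ × ℕ) → ℕ, (∀ J, 1 ≤ J.2.1 → 1 ≤ J.2.2 → solD J (f J)) ∧ ∃ T : ℕ → ℕ → ℕ, expPoly δ T ∧ ∃ M, Literature.Computability.Complexity.ComputesInTime encD Computability.encodeNat f (fun J => T J.1.1 (encD J).length) M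
def imat : Computability.Encoding (Σ n : ℕ, Matrix (Fin n) (Fin n) ℤ) Bool := Computability.Encoding.sigmaBool fun n => (Literature.Computability.Complexity.encodingFinVec Literature.Computability.Complexity.encodingIntBool (n * n)).ofEquiv (Matrix.of.symm.trans ((Equiv.curry (Fin n) (Fin n) ℤ).symm.trans (finProdFinEquiv.arrowCongr (Equiv.refl ℤ))))
def solM : (B : (Σ n : ℕ, Matrix (Fin n) (Fin n) ℤ)) → (Fin B.1 → ℤ) → Prop := fun B z => z ≠ 0 ∧ ∀ j : Fin B.1, |Matrix.vecMul z B.2 j| ^ B.1 ≤ |B.2.det|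
def minkowskiInExpTime : ℝ → Prop := fun δ => ∃ g : (Σ n : ℕ, Matrix (Fin n) (Fin n) ℤ) → List Bool, (∀ B : (Σ n : ℕ, Matrix (Fin n) (Fin n) ℤ), B.2.det ≠ 0 → 1 ≤ B.1 → solM B (((Literature.Computability.Complexity.encodingFinVec Literature.Computability.Complexity.encodingIntBool B.1).decode (g B)).getD 0)) ∧ ∃ T : ℕ → ℕ → ℕ, expPoly δ T ∧ ∃ M, Literature.Computability.Complexity.ComputesInTime imat.encode (id : List Bool → List Bool) g (fun B => T B.1 (imat.encode B).length) M

/-- The crux in the named vocabulary (definitional unfolding). -/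
theorem minkowskiToDirichlet_iff :
    Summit.PneNP.PneNP.Theses.DirichletPigeons.MinkowskiToDirichlet ↔ ∃ c : ℝ, 0 < c ∧ ∀ δ : ℝ, 0 < δ → dirichletInExpTime δ → minkowskiInExpTime (c * δ) :=
  Iff.rfl

/-! ### The two normal forms of MINKOWSKI_∞ -/

/-- MINKOWSKI_∞ solutions on the HECKE lattice `Λ(a, D, s)` (rows `(s, a)`, `D·eᵢ`; `det = s·D^d`,
`n = d+1`): `z = (q, p) ≠ 0`, `|s q|^{d+1} ≤ s D^d`, `|q aᵢ + D pᵢ|^{d+1} ≤ s D^d`. Instance `K = (⟨d,a⟩, D, s)`. -/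
def solH : (K : (Σ d : ℕ, Fin d → ℤ) × ℕ × ℕ) → (Fin (K.1.1 + 1) → ℤ) → Prop := fun K z => z ≠ 0 ∧ |(K.2.2 : ℤ) * z 0| ^ (K.1.1 + 1) ≤ (K.2.2 : ℤ) * (K.2.1 : ℤ) ^ K.1.1 ∧ ∀ i : Fin K.1.1, |z 0 * K.1.2 i + (K.2.1 : ℤ) * z i.succ| ^ (K.1.1 + 1) ≤ (K.2.2 : ℤ) * (K.2.1 : ℤ) ^ K.1.1

/-- "Hecke-form MINKOWSKI_∞ ∈ FTIME(2^{δ d}·poly)" (promise `1 ≤ D`, `1 ≤ s`; output = code of `z` in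
`encodingFinVec encodingIntBool (d+1)`, junk ↦ no solution). -/
def heckeInExpTime : ℝ → Prop := fun δ => ∃ g : ((Σ d : ℕ, Fin d → ℤ) × ℕ × ℕ) → List Bool, (∀ K : (Σ d : ℕ, Fin d → ℤ) × ℕ × ℕ, 1 ≤ K.2.1 → 1 ≤ K.2.2 → solH K (((Literature.Computability.Complexity.encodingFinVec Literature.Computability.Complexity.encodingIntBool (K.1.1 + 1)).decode (g K)).getD 0)) ∧ ∃ T : ℕ → ℕ → ℕ, expPoly δ T ∧ ∃ M, Literature.Computability.Complexity.ComputesInTime encD (id : List Bool → List Bool) g (fun K => T K.1.1 (encD K).length) M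

/-- MINKOWSKI_∞ solutions on the POWER-FORM Hecke lattice: instance `P = (⟨d,a⟩, s, Q)`, modulus
`D := s·Q^{d+1}`, `det = s·D^d`. -/
def solP : (P : (Σ d : ℕ, Fin d → ℤ) × ℕ × ℕ) → (Fin (P.1.1 + 1) → ℤ) → Prop := fun P z => z ≠ 0 ∧ |(P.2.1 : ℤ) * z 0| ^ (P.1.1 + 1) ≤ (P.2.1 : ℤ) * ((P.2.1 : ℤ) * (P.2.2 : ℤ) ^ (P.1.1 + 1)) ^ P.1.1 ∧ ∀ i : Fin P.1.1, |z 0 * P.1.2 i + ((P.2.1 : ℤ) * (P.2.2 : ℤ) ^ (P.1.1 + 1)) * z i.succ| ^ (P.1.1 + 1) ≤ (P.2.1 : ℤ) * ((P.2.1 : ℤ) * (P.2.2 : ℤ) ^ (P.1.1 + 1)) ^ P.1.1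

/-- "Power-form MINKOWSKI_∞ ∈ FTIME(2^{δ d}·poly)" (promise `1 ≤ s`, `1 ≤ Q`). -/
def powerInExpTime : ℝ → Prop := fun δ => ∃ g : ((Σ d : ℕ, Fin d → ℤ) × ℕ × ℕ) → List Bool, (∀ P : (Σ d : ℕ, Fin d → ℤ) × ℕ × ℕ, 1 ≤ P.2.1 → 1 ≤ P.2.2 → solP P (((Literature.Computability.Complexity.encodingFinVec Literature.Computability.Complexity.encodingIntBool (P.1.1 + 1)).decode (g P)).getD 0)) ∧ ∃ T : ℕ → ℕ → ℕ, expPoly δ T ∧ ∃ M, Literature.Computability.Complexity.ComputesInTime encD (id : List Bool → List Bool) g (fun P => T P.1.1 (encD P).length) M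

/-! ### Registered stubs -/

/-- STUB A1 (structural normal form — HARDEST): a `2^{δ d}·poly` solver for Hecke-form MINKOWSKI_∞
yields a `2^{c δ n}·poly` solver for MINKOWSKI_∞ on every nonsingular `B ∈ ℤ^{n×n}`. Tools: HNF,
Paz–Schnorr cyclic-lattice approximation, the integrality slack `‖x‖_∞ ≤ ⌊det^{1/n}⌋`, scaling by a
Dirichlet-chosen integer to create slack. [Paz–Schnorr 1987 (approximating lattices by cyclic ones);
Micciancio–Regev 2009 survey; SZZ18 §6] -/
theorem stub_heckeOfMinkowski :
    ∃ c : ℝ, 0 < c ∧ ∀ δ : ℝ, 0 < δ → heckeInExpTime δ → minkowskiInExpTime (c * δ) := by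
  sorry

/-- STUB A2 (modulus rounding): a `2^{δ d}·poly` solver for the power form (`D = s·Q^{d+1}`) yields a
`2^{c δ d}·poly` solver for every Hecke-form instance `(a, D, s)`. The exactness of Minkowski's bound
on both sides is the difficulty (no slack except integrality); dimension padding is allowed as long as
it is linear. [folklore; this is where C3's "exact cube → Dirichlet box" worry lives] -/
theorem stub_heckeOfPower :
    ∃ c : ℝ, 0 < c ∧ ∀ δ : ℝ, 0 < δ → powerInExpTime δ → heckeInExpTime (c * δ) := by
  sorry

/-- STUB B (Dirichlet's box is Minkowski's cube on power-form Hecke lattices; PROVABLE NOW modulo TM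
plumbing, `c = 1`): a `2^{δ d}·poly` DIRICHLET solver yields a `2^{c δ d}·poly` power-form solver —
call DIRICHLET on `(a, b := s·Q^{d+1}, Q)` and return `(q, −round(q a/b))`. [Dirichlet 1842 /
Hardy–Wright Thm 200; BanEtAl2019 (DIRICHLET ≤ MINKOWSKI is the same identity read backwards)] -/
theorem stub_powerOfDirichlet :
    ∃ c : ℝ, 0 < c ∧ ∀ δ : ℝ, 0 < δ → dirichletInExpTime δ → powerInExpTime (c * δ) := by
  sorry

/-! ### Kernel-checked composition -/

/-- **The line concludes the crux**: `A1 → A2 → B → MinkowskiToDirichlet`, with constant `c₁ c₂ c₃`. -/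
theorem MinkowskiToDirichlet_of :
    (∃ c : ℝ, 0 < c ∧ ∀ δ : ℝ, 0 < δ → heckeInExpTime δ → minkowskiInExpTime (c * δ)) →
    (∃ c : ℝ, 0 < c ∧ ∀ δ : ℝ, 0 < δ → powerInExpTime δ → heckeInExpTime (c * δ)) →
    (∃ c : ℝ, 0 < c ∧ ∀ δ : ℝ, 0 < δ → dirichletInExpTime δ → powerInExpTime (c * δ)) →
    Summit.PneNP.PneNP.Theses.DirichletPigeons.MinkowskiToDirichlet := by
  rintro ⟨c₁, hc₁, h₁⟩ ⟨c₂, hc₂, h₂⟩ ⟨c₃, hc₃, h₃⟩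
  rw [minkowskiToDirichlet_iff]
  refine ⟨c₁ * c₂ * c₃, by positivity, fun δ hδ hD => ?_⟩
  have hP : powerInExpTime (c₃ * δ) := h₃ δ hδ hD
  have hH : heckeInExpTime (c₂ * (c₃ * δ)) := h₂ (c₃ * δ) (by positivity) hP
  have hM : minkowskiInExpTime (c₁ * (c₂ * (c₃ * δ))) := h₁ (c₂ * (c₃ * δ)) (by positivity) hH
  simpa only [mul_assoc] using hM

/-- **Skeleton certificate** (`ledger skeleton check`): the registered stubs prove the ROUTE DECL by name.
Depends on `sorry` exactly through the `stub_*` above. -/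
theorem MinkowskiToDirichlet_proof : Summit.PneNP.PneNP.Theses.DirichletPigeons.MinkowskiToDirichlet :=
  MinkowskiToDirichlet_of stub_heckeOfMinkowski stub_heckeOfPower stub_powerOfDirichlet

end Summit.PneNP.PneNP.Cruxes.GsaPriceOfDimension.HeckeNormalForm
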